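import Summits.ABC.StewartYu.PadicW80ParF
import HarnessLib

/-!
# The `p`-adic Waldschmidt numerics (WP-A4, cell abc-stewartyu): the extrapolation inequalities

Support file (theorems only), sequel to `PadicW80Par.lean`. It discharges the two logarithmic
inequalities behind p2's `PadicCW77.Setup.kFinal_of_log_ineq` (`KFinal`, the inner `k`-steps,
`k < d`) and the two behind p3's `hFinalHalf_of_log_ineq` (`HFinalHalf`, the half step) for the
parameter record `PadicW80Par` — with the archimedean size inputs `log(Dmax·Mmax)` (k-step) and `B`
(half step) as ABSTRACT budgets (`≤ 𝔘/4 + 2ᵏ𝔘/16`, resp. `≤ (7/16)·2ᵈ𝔘`) to be met by p3's closed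
forms (junction J2; W80's values are `≈ 0.16𝔘 + 0.001·2ᵏ𝔘` resp. `≈ 0.375·2ᵈ𝔘`):

* `condSum_mul_log_le` — the node-conditioning exponent of `PadicCW77KStep.condExp`
  (`∑_{j < log_p(2 kpts)} t(⌊kpts/p^{j+1}⌋ + 1)`, written out) costs
  `≤ kpts·t·log p/(p−1) + t·log(2 kpts)` — `p`-uniform (Legendre);
* `kstep_ineq_one`, `kstep_ineq_two` — (1) `(⌊hL_b/(p−1)⌋ + ⌊(t−1)/(p−1)⌋ + cond)·log p +
  log(Dmax·Mmax) < U` and (2) `hL_b·log p + log(Dmax·Mmax) < (kpts·t/2)·log p`, from `kpts·t ∈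
  [(31/32)·2ᵏ𝔘, 2ᵏ𝔘]` (`KT_ge/KT_le`), `log p/(p−1) ≤ 1`, `log p ≥ 1` (`p ≥ 3`), `U = 2^{d+1}𝔘`;
* `halfstep_ineq_one`, `halfstep_ineq_two` — the same at `kpts' = 2^{d+J}S₀/2` against the
  half-step threshold `B`;
* (`log_p_le_U`, `room_half` live in `PadicW80ParF`.)

## References
* [Waldschmidt1980] M. Waldschmidt, Acta Arith. 37 (1980), Lemmas 3.5–3.7 (pp. 271–273).
* [Yu1989] K. Yu, Acta Arith. 53 (1989), Lemma 1.4 (p. 117) — the Legendre conditioning.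
-/

noncomputable section

open Finset Real

open Literature.NumberTheory.Transcendental Literature.NumberTheory.Transcendental.Waldschmidt1980

namespace Summit.ABC.StewartYu

namespace PadicW80Par

variable {d : ℕ} (P : PadicW80Par d)

/-! ### Elementary facts about `log p` -/

omit P in
/-- `log p ≤ p − 1`, i.e. `x·log p/(p−1) ≤ x`. [folklore] -/
private theorem log_le_sub_one_nat {p : ℕ} (hp : 2 ≤ p) : Real.log p ≤ (p : ℝ) - 1 :=
  Real.log_le_sub_one_of_pos (by exact_mod_cast (by omega : 0 < p))

omit P in
/-- `1 ≤ log p` for `p ≥ 3` (`e < 3`). [folklore] -/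
private theorem one_le_log_nat {p : ℕ} (hp : 3 ≤ p) : (1 : ℝ) ≤ Real.log p := by
  rw [Real.le_log_iff_exp_le (by exact_mod_cast (by omega : 0 < p))]
  have := Real.exp_one_lt_d9
  have h3 : (3 : ℝ) ≤ p := by exact_mod_cast hp
  linarith

/-! ### The conditioning exponent -/

omit P in
/-- `∑_{j<N} (1/p)^{j+1} = (1 − (1/p)^N)/(p − 1)`. [folklore] -/
private theorem geom_sum_inv (p : ℕ) (hp : 2 ≤ p) (N : ℕ) :
    ∑ j ∈ range N, ((1 : ℝ) / p) ^ (j + 1) = (1 - (1 / (p : ℝ)) ^ N) / ((p : ℝ) - 1) := by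
  have hp1 : (1 : ℝ) < p := by exact_mod_cast (by omega : 1 < p)
  have hne : (p : ℝ) - 1 ≠ 0 := by linarith
  have hp0 : (p : ℝ) ≠ 0 := by positivity
  induction N with
  | zero => simp
  | succ N ih =>
    rw [sum_range_succ, ih, pow_succ, div_add' _ _ _ hne, div_eq_div_iff hne hne]
    field_simp
    ring

omit P in
/-- **The node conditioning costs at most `kpts·t·log p/(p−1) + t·log(2·kpts)`**: for the
exponent `∑_{j < ⌊log_p(2 kpts)⌋} t(⌊kpts/p^{j+1}⌋ + 1)` of `PadicCW77KStep.condExp` (written out),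
`(…)·log p ≤ kpts·t·log p/(p−1) + t·log(2 kpts)` (`∑ ⌊kpts/p^{j+1}⌋ ≤ kpts/(p−1)`;
`p^{⌊log_p(2kpts)⌋} ≤ 2 kpts`). [cite: Yu1989, Lemma 1.4 (p. 117)] -/
theorem condSum_mul_log_le {p : ℕ} (hp : 2 ≤ p) (kpts t : ℕ) (hk : 1 ≤ kpts) :
    ((∑ j ∈ range (Nat.log p (2 * kpts)), t * (kpts / p ^ (j + 1) + 1) : ℕ) : ℝ) * Real.log p ≤
      (kpts : ℝ) * t * Real.log p / ((p : ℝ) - 1) + t * Real.log (2 * (kpts : ℝ)) := by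
  have hp0 : (0 : ℝ) < p := by exact_mod_cast (by omega : 0 < p)
  have hp1 : (1 : ℝ) < p := by exact_mod_cast (by omega : 1 < p)
  have hlogp : 0 ≤ Real.log p := Real.log_nonneg hp1.le
  set N := Nat.log p (2 * kpts) with hN
  -- split the sum
  have hsplit : ((∑ j ∈ range N, t * (kpts / p ^ (j + 1) + 1) : ℕ) : ℝ) =
      (t : ℝ) * (∑ j ∈ range N, ((kpts / p ^ (j + 1) : ℕ) : ℝ)) + (t : ℝ) * N := by
    push_cast
    rw [show (∑ x ∈ range N, (t : ℝ) * (((kpts / p ^ (x + 1) : ℕ) : ℝ) + 1)) =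
        ∑ x ∈ range N, ((t : ℝ) * (((kpts / p ^ (x + 1) : ℕ) : ℝ)) + (t : ℝ)) from
        sum_congr rfl (fun x _ => by ring), sum_add_distrib, sum_const, card_range, nsmul_eq_mul,
      mul_sum]
    ring
  -- the floor sum against the geometric series
  have hgeom : (∑ j ∈ range N, ((kpts / p ^ (j + 1) : ℕ) : ℝ)) ≤ (kpts : ℝ) / ((p : ℝ) - 1) := by
    calc (∑ j ∈ range N, ((kpts / p ^ (j + 1) : ℕ) : ℝ))
        ≤ ∑ j ∈ range N, (kpts : ℝ) * ((1 : ℝ) / p) ^ (j + 1) := by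
          refine sum_le_sum fun j _ => ?_
          have h := Nat.cast_div_le (α := ℝ) (m := kpts) (n := p ^ (j + 1))
          rw [one_div, inv_pow, ← div_eq_mul_inv]
          push_cast at h ⊢
          exact h
      _ = (kpts : ℝ) * ((1 - (1 / (p : ℝ)) ^ N) / ((p : ℝ) - 1)) := by
          rw [← Finset.mul_sum, geom_sum_inv p hp N]
      _ ≤ (kpts : ℝ) * (1 / ((p : ℝ) - 1)) := by
          refine mul_le_mul_of_nonneg_left ?_ (Nat.cast_nonneg _)
          apply div_le_div_of_nonneg_right _ (by linarith)
          have : (0 : ℝ) ≤ (1 / (p : ℝ)) ^ N := by positivity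
          linarith
      _ = (kpts : ℝ) / ((p : ℝ) - 1) := by ring
  -- the number of levels against `log(2 kpts)`
  have hNlog : (N : ℝ) * Real.log p ≤ Real.log (2 * (kpts : ℝ)) := by
    have hpow : p ^ N ≤ 2 * kpts := Nat.pow_log_le_self p (by omega)
    have h1 : ((p : ℝ)) ^ N ≤ 2 * (kpts : ℝ) := by exact_mod_cast hpow
    rw [← Real.log_pow]
    exact Real.log_le_log (by positivity) h1
  rw [hsplit, add_mul]
  have ht0 : (0 : ℝ) ≤ t := Nat.cast_nonneg _
  have e1 : (t : ℝ) * (∑ j ∈ range N, ((kpts / p ^ (j + 1) : ℕ) : ℝ)) * Real.log p ≤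
      (kpts : ℝ) * t * Real.log p / ((p : ℝ) - 1) := by
    calc (t : ℝ) * (∑ j ∈ range N, ((kpts / p ^ (j + 1) : ℕ) : ℝ)) * Real.log p
        ≤ (t : ℝ) * ((kpts : ℝ) / ((p : ℝ) - 1)) * Real.log p := by gcongr
      _ = (kpts : ℝ) * t * Real.log p / ((p : ℝ) - 1) := by ring
  have e2 : (t : ℝ) * N * Real.log p ≤ t * Real.log (2 * (kpts : ℝ)) := by
    rw [mul_assoc]; exact mul_le_mul_of_nonneg_left hNlog ht0
  linarith

/-! ### Small parameters against `𝔘` -/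

/-- `t_J · log(2·kpts) ≤ 𝔘/128` for the nodes of any inner step (`kpts ≤ 2^{d+J₀} S₀`,
`2^{J₀} ≤ 2L_θ`, `L_θ S₀ ≤ 𝔘/2¹⁴`, `log 𝔘 ≤ log U ≤ 10 W⋆`, `T W⋆ ≤ 𝔘/c_T`). [folklore] -/
theorem t_mul_log_kpts_le {J k : ℕ} (hJ : J < P.J₀p) (hk : k ≤ d) :
    (P.tJp J : ℝ) * Real.log (2 * ((2 ^ (k + J) * P.S₀p / 2 : ℕ) : ℝ)) ≤ P.𝔘p / 128 := by
  have hkp := P.kpts_le_nat hJ.le hk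
  have hLS := P.LθS₀_le
  have hpow : ((2 : ℕ) ^ P.J₀p : ℝ) ≤ 2 * P.Lθp := by exact_mod_cast P.two_pow_le
  have hU := P.𝔘_pos; have hW := P.one_le_Wstar; have hWU := P.Wstar_le_𝔘
  have hT := P.T_pos; have hTW := P.TWstar_le; have hm := two_le_mR P
  have hlogU := P.log_U_le
  -- `2 kpts ≤ 2 · 2^d · 2^{J₀} S₀ ≤ 2^{d+2} Lθ S₀ ≤ 2^{d+2} 𝔘/2^14 ≤ U`
  have h1 : 2 * ((2 ^ (k + J) * P.S₀p / 2 : ℕ) : ℝ) ≤ P.Up := by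
    have hk' : ((2 ^ (k + J) * P.S₀p / 2 : ℕ) : ℝ) ≤ ((2 ^ (d + P.J₀p) * P.S₀p : ℕ) : ℝ) := by
      exact_mod_cast hkp
    have hS : (0 : ℝ) ≤ P.S₀p := P.S₀_pos.le
    calc 2 * ((2 ^ (k + J) * P.S₀p / 2 : ℕ) : ℝ) ≤ 2 * ((2 ^ (d + P.J₀p) * P.S₀p : ℕ) : ℝ) := by linarith
      _ = 2 * 2 ^ d * ((2 : ℕ) ^ P.J₀p : ℝ) * P.S₀p := by push_cast; ring
      _ ≤ 2 * 2 ^ d * (2 * P.Lθp) * P.S₀p := by gcongr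
      _ = 2 ^ (d + 2) * (P.Lθp * P.S₀p) := by ring
      _ ≤ 2 ^ (d + 2) * (P.𝔘p / 2 ^ 14) := by gcongr
      _ ≤ 2 ^ (d + 1) * P.𝔘p := by
          rw [show (2 : ℝ) ^ (d + 2) = 2 ^ (d + 1) * 2 by ring]
          have : (0 : ℝ) ≤ 2 ^ (d + 1) := by positivity
          nlinarith
      _ = P.Up := P.U_eq.symm
  have hkpos : (0 : ℝ) < 2 * ((2 ^ (k + J) * P.S₀p / 2 : ℕ) : ℝ) := by
    have hS2 := P.two_le_S₀
    have : 1 ≤ 2 ^ (k + J) * P.S₀p / 2 := by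
      rw [Nat.le_div_iff_mul_le two_pos]
      calc 1 * 2 = 2 := by ring
        _ ≤ 2 ^ (k + J) * 2 := Nat.le_mul_of_pos_left 2 (Nat.pow_pos two_pos)
        _ ≤ 2 ^ (k + J) * P.S₀p := Nat.mul_le_mul_left _ hS2
    have : (1 : ℝ) ≤ ((2 ^ (k + J) * P.S₀p / 2 : ℕ) : ℝ) := by exact_mod_cast this
    linarith
  have hk1r : (1 : ℝ) ≤ 2 * ((2 ^ (k + J) * P.S₀p / 2 : ℕ) : ℝ) := by
    have hS2 := P.two_le_S₀
    have : 1 ≤ 2 ^ (k + J) * P.S₀p / 2 := by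
      rw [Nat.le_div_iff_mul_le two_pos]
      calc 1 * 2 = 2 := by ring
        _ ≤ 2 ^ (k + J) * 2 := Nat.le_mul_of_pos_left 2 (Nat.pow_pos two_pos)
        _ ≤ 2 ^ (k + J) * P.S₀p := Nat.mul_le_mul_left _ hS2
    have : (1 : ℝ) ≤ ((2 ^ (k + J) * P.S₀p / 2 : ℕ) : ℝ) := by exact_mod_cast this
    linarith
  have h2 : Real.log (2 * ((2 ^ (k + J) * P.S₀p / 2 : ℕ) : ℝ)) ≤ 10 * P.Wstarp :=
    (Real.log_le_log hkpos h1).trans hlogU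
  have ht : (P.tJp J : ℝ) ≤ P.Tp := by exact_mod_cast P.tJ_le_T J
  have ht0 : (0 : ℝ) ≤ P.tJp J := Nat.cast_nonneg _
  calc (P.tJp J : ℝ) * Real.log (2 * ((2 ^ (k + J) * P.S₀p / 2 : ℕ) : ℝ))
      ≤ P.Tp * (10 * P.Wstarp) := mul_le_mul ht h2 (Real.log_nonneg hk1r) hT.le
    _ = 10 * (P.Tp * P.Wstarp) := by ring
    _ ≤ 10 * (P.𝔘p / cTp) := by gcongr
    _ ≤ P.𝔘p / 128 := by unfold cTp; nlinarith

/-! ### The `k`-step inequalities (targets of `kFinal_of_log_ineq`) -/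

/-- **k-step, smallness branch (1)**: for `J < J₀`, `k < d`, `t = t_J`, `kpts = 2^{k+J}S₀/2` and any
size budget `log(Dmax·Mmax) ≤ 𝔘/4 + 2ᵏ𝔘/16`:
`(⌊hL_b/(p−1)⌋ + ⌊(t−1)/(p−1)⌋ + cond)·log p + log(Dmax·Mmax) < U` (the conditioning written out as in
`PadicCW77KStep.condExp`; `p ≥ 3`). [cite: Waldschmidt1980, Lemma 3.6 (p. 272)] -/
theorem kstep_ineq_one {p : ℕ} (hp : 3 ≤ p) {J k : ℕ} (hJ : J < P.J₀p) (hk : k < d) {logDM : ℝ}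
    (hDM : logDM ≤ P.𝔘p / 4 + 2 ^ k * P.𝔘p / 16) :
    ((P.hparp * P.Lbp / (p - 1) + (P.tJp J - 1) / (p - 1) +
        ∑ j ∈ range (Nat.log p (2 * (2 ^ (k + J) * P.S₀p / 2))),
          P.tJp J * ((2 ^ (k + J) * P.S₀p / 2) / p ^ (j + 1) + 1) : ℕ) : ℝ) * Real.log p + logDM <
      P.Up := by
  have hp2 : 2 ≤ p := by omega
  have hp1 : (1 : ℝ) < p := by exact_mod_cast (by omega : 1 < p)
  have hlogp1 := one_le_log_nat hp
  have hlogp0 : 0 ≤ Real.log p := by linarith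
  have hlps := log_le_sub_one_nat hp2
  have hpm1 : (0 : ℝ) < (p : ℝ) - 1 := by linarith
  have hU := P.𝔘_pos; have hW := P.one_le_Wstar; have hWU := P.Wstar_le_𝔘
  have hhLb := P.hparLb_le; have hT := P.T_le_𝔘; have hTpos := P.T_pos
  have hKT := P.KT_le J k
  have htl := P.t_mul_log_kpts_le hJ hk.le
  set kpts : ℕ := 2 ^ (k + J) * P.S₀p / 2 with hkpts
  set t : ℕ := P.tJp J with ht
  have hk1 : 1 ≤ kpts := by
    rw [hkpts, Nat.le_div_iff_mul_le two_pos]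
    calc 1 * 2 = 2 := by ring
      _ ≤ 2 ^ (k + J) * 2 := Nat.le_mul_of_pos_left 2 (Nat.pow_pos two_pos)
      _ ≤ 2 ^ (k + J) * P.S₀p := Nat.mul_le_mul_left _ P.two_le_S₀
  have htT : (t : ℝ) ≤ P.Tp := by exact_mod_cast P.tJ_le_T J
  -- casts of the floor divisions
  have hc1 : ((P.hparp * P.Lbp / (p - 1) : ℕ) : ℝ) ≤ (P.hparp : ℝ) * P.Lbp / ((p : ℝ) - 1) := by
    have h := Nat.cast_div_le (α := ℝ) (m := P.hparp * P.Lbp) (n := p - 1)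
    have e : ((p - 1 : ℕ) : ℝ) = (p : ℝ) - 1 := by rw [Nat.cast_sub (by omega)]; simp
    rw [e] at h; push_cast at h; exact h
  have hc2 : (((t - 1) / (p - 1) : ℕ) : ℝ) ≤ (t : ℝ) / ((p : ℝ) - 1) := by
    have h := Nat.cast_div_le (α := ℝ) (m := t - 1) (n := p - 1)
    have e : ((p - 1 : ℕ) : ℝ) = (p : ℝ) - 1 := by rw [Nat.cast_sub (by omega)]; simp
    rw [e] at h
    have h2 : ((t - 1 : ℕ) : ℝ) ≤ t := by exact_mod_cast Nat.sub_le t 1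
    exact h.trans (div_le_div_of_nonneg_right h2 hpm1.le)
  have hcond := condSum_mul_log_le hp2 kpts t hk1
  -- `x·log p/(p−1) ≤ x`
  have hdiv : ∀ x : ℝ, 0 ≤ x → x / ((p : ℝ) - 1) * Real.log p ≤ x := by
    intro x hx
    rw [div_mul_eq_mul_div, div_le_iff₀ hpm1]
    exact mul_le_mul_of_nonneg_left hlps hx
  have hhLb0 : (0 : ℝ) ≤ (P.hparp : ℝ) * P.Lbp := by positivity
  have ht0 : (0 : ℝ) ≤ t := Nat.cast_nonneg _
  have hkt0 : (0 : ℝ) ≤ (kpts : ℝ) * t := by positivity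
  -- assemble
  have hsum : ((P.hparp * P.Lbp / (p - 1) + (t - 1) / (p - 1) +
        ∑ j ∈ range (Nat.log p (2 * kpts)), t * (kpts / p ^ (j + 1) + 1) : ℕ) : ℝ) * Real.log p ≤
      (P.hparp : ℝ) * P.Lbp + t + ((kpts : ℝ) * t + P.𝔘p / 128) := by
    have e1 := hdiv _ hhLb0
    have e2 := hdiv _ ht0
    have e3 : ((kpts : ℝ) * t * Real.log p / ((p : ℝ) - 1)) ≤ (kpts : ℝ) * t := by
      have := hdiv _ hkt0; rwa [div_mul_eq_mul_div] at this
    have hA : ((P.hparp * P.Lbp / (p - 1) : ℕ) : ℝ) * Real.log p ≤ (P.hparp : ℝ) * P.Lbp :=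
      (mul_le_mul_of_nonneg_right hc1 hlogp0).trans e1
    have hB : (((t - 1) / (p - 1) : ℕ) : ℝ) * Real.log p ≤ t :=
      (mul_le_mul_of_nonneg_right hc2 hlogp0).trans e2
    have hC : ((∑ j ∈ range (Nat.log p (2 * kpts)), t * (kpts / p ^ (j + 1) + 1) : ℕ) : ℝ) *
        Real.log p ≤ (kpts : ℝ) * t + P.𝔘p / 128 := by
      refine hcond.trans ?_
      have := htl
      linarith
    have esplit : ((P.hparp * P.Lbp / (p - 1) + (t - 1) / (p - 1) +
          ∑ j ∈ range (Nat.log p (2 * kpts)), t * (kpts / p ^ (j + 1) + 1) : ℕ) : ℝ) * Real.log p =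
        ((P.hparp * P.Lbp / (p - 1) : ℕ) : ℝ) * Real.log p + (((t - 1) / (p - 1) : ℕ) : ℝ) * Real.log p +
          ((∑ j ∈ range (Nat.log p (2 * kpts)), t * (kpts / p ^ (j + 1) + 1) : ℕ) : ℝ) * Real.log p := by
      push_cast; ring
    rw [esplit]
    linarith
  -- numbers: `hLb ≤ 𝔘/c_L + 3W⋆`, `t ≤ 𝔘/c_T`, `kpts t ≤ 2^k 𝔘`, `U = 2^{d+1}𝔘 ≥ 4·2^k 𝔘`
  have hkt : (kpts : ℝ) * t ≤ 2 ^ k * P.𝔘p := hKT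
  have h2k : (4 : ℝ) * 2 ^ k ≤ 2 ^ (d + 1) := by
    have : (2 : ℝ) ^ (k + 2) ≤ 2 ^ (d + 1) := pow_le_pow_right₀ (by norm_num) (by omega)
    calc (4 : ℝ) * 2 ^ k = 2 ^ (k + 2) := by rw [pow_add]; norm_num; ring
      _ ≤ 2 ^ (d + 1) := this
  rw [P.U_eq]
  have h2k1 : (1 : ℝ) ≤ 2 ^ k := one_le_pow₀ (by norm_num)
  have h4 : 4 * (2 ^ k * P.𝔘p) ≤ 2 ^ (d + 1) * P.𝔘p := by nlinarith [h2k, hU.le]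
  have h5 : P.𝔘p ≤ 2 ^ k * P.𝔘p := by nlinarith
  unfold cLp at hhLb; unfold cTp at hT
  have : (P.hparp : ℝ) * P.Lbp + t + ((kpts : ℝ) * t + P.𝔘p / 128) + logDM < 2 ^ (d + 1) * P.𝔘p := by
    linarith
  linarith

/-- **k-step, gain branch (2)**: `hL_b·log p + log(Dmax·Mmax) < (kpts·t/2)·log p` for `J < J₀`,
`k < d` and any size budget `log(Dmax·Mmax) ≤ 𝔘/4 + 2ᵏ𝔘/16` (`kpts·t ≥ (31/32) 2ᵏ𝔘`, `log p ≥ 1`).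
[cite: Waldschmidt1980, Lemma 3.6 (p. 272)] -/
theorem kstep_ineq_two {p : ℕ} (hp : 3 ≤ p) {J k : ℕ} (hJ : J < P.J₀p) (_hk : k < d) {logDM : ℝ}
    (hDM : logDM ≤ P.𝔘p / 4 + 2 ^ k * P.𝔘p / 16) :
    ((P.hparp * P.Lbp : ℕ) : ℝ) * Real.log p + logDM <
      (((2 ^ (k + J) * P.S₀p / 2) * P.tJp J : ℕ) : ℝ) / 2 * Real.log p := by
  have hlogp1 := one_le_log_nat hp
  have hU := P.𝔘_pos; have hW := P.one_le_Wstar; have hWU := P.Wstar_le_𝔘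
  have hhLb := P.hparLb_le
  have hKT := P.KT_ge hJ k
  push_cast at hKT ⊢
  have h2k1 : (1 : ℝ) ≤ 2 ^ k := one_le_pow₀ (by norm_num)
  -- `hLb + budget < (31/64)·2^k·𝔘`, then multiply by `log p ≥ 1`
  have key : (P.hparp : ℝ) * P.Lbp + (P.𝔘p / 4 + 2 ^ k * P.𝔘p / 16) <
      31 / 32 * (2 ^ k * P.𝔘p) / 2 := by
    unfold cLp at hhLb; nlinarith
  have hX : P.𝔘p / 4 + 2 ^ k * P.𝔘p / 16 ≤ (P.𝔘p / 4 + 2 ^ k * P.𝔘p / 16) * Real.log p := by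
    have h0 : (0 : ℝ) ≤ P.𝔘p / 4 + 2 ^ k * P.𝔘p / 16 := by positivity
    nlinarith
  have h0' : (0 : ℝ) ≤ (P.hparp : ℝ) * P.Lbp := by positivity
  nlinarith [mul_le_mul_of_nonneg_right hKT (le_trans zero_le_one hlogp1)]

end PadicW80Par

end Summit.ABC.StewartYu

end
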